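import Summits.ResolutionOfSingularities.ResolutionOfSingularities.Theorems.FrobeniusLadderFRationalResolutionPushoutDegreeGroup
import Summits.ResolutionOfSingularities.ResolutionOfSingularities.Theorems.FrobeniusLadderFRationalResolutionFixedChartOfWildDegree
import Summits.ResolutionOfSingularities.ResolutionOfSingularities.Theorems.FrobeniusLadderFRationalResolutionRootAdjoinRegularOfTameDegree
import Summits.ResolutionOfSingularities.ResolutionOfSingularities.Theorems.FrobeniusLadderFRationalResolutionRootAdjoinRechart
import Summits.ResolutionOfSingularities.ResolutionOfSingularities.Theorems.FrobeniusLadderFRationalResolutionSubchartOfSummand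
import Summits.ResolutionOfSingularities.ResolutionOfSingularities.Theorems.FrobeniusLadderFRationalResolutionRegradeChart
import Mathlib.Data.Nat.Factorization.Basic
import Mathlib.Algebra.Group.Subgroup.Finite
import HarnessLib

/-!
# Crux `FrobeniusLadder.FRationalResolution` (stmt-ResolutionOfSingularities-15317), line `redirect`,
# stub `stub_diagonalizableQuotientResolution` — item (F2c): choosing the degree to take a root of — in a nonzero finite abelian
# group `B` there is an element `b` of prime-power order `ℓ^{e+1}` outside `ℓ·B`

First brick of the re-charting STEP of MEMO-15317-leafhand2-g22: the unit-degree subgroup `B ≠ 0` of a non-fixed point contains,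
for some prime `ℓ ∣ |B|`, an element `b ∈ B ∖ ℓ·B` of order a power of `ℓ` (take `g ∉ ℓ·B` by Cauchy, `…FixedChartOfWildDegree`,
and its prime-to-`ℓ` multiple). Such a `b` is admissible for BOTH regularity certificates of the root adjunction (`ℓ = char k`:
`b ∉ ℓ·B`, `…FixedChartOfWildDegree`; `ℓ ≠ char k`: exponent `d = ℓ^f ∈ k^×`, `…RootAdjoinRegularOfTameDegree`) and for the
prescribed character `…ZModCharacterPrescribed` (prime-power order).

* `exists_primePow_order_not_mem_nsmul` — the statement above.

Honest label: helper toward ONE leaf stub; no stub, crux or summit closed. No definitions, no named facts, no sorry. [folklore]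
-/

noncomputable section

-- single-problem summit: the doubled namespace component is forced
set_option linter.dupNamespace false

namespace Summit.ResolutionOfSingularities.ResolutionOfSingularities.Theorems.FRationalResolution.RechartDegree

/-- In a monoid, `k • g = g` when `k ≡ 1 (mod ord g)`. [folklore] -/
theorem nsmul_eq_self_of_mod_eq_one {G : Type} [AddCommGroup G] (g : G) {k : ℕ} (hk : k % addOrderOf g = 1) : k • g = g := by
  conv_lhs => rw [← Nat.div_add_mod k (addOrderOf g), hk, add_nsmul, one_nsmul, mul_nsmul,
    addOrderOf_nsmul_eq_zero, nsmul_zero, zero_add]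

/-- **A degree to take a root of.** In a nonzero finite abelian group `B` (inside `A`) there are a prime `ℓ ∣ |B|` and `b ∈ B` of
order `ℓ^(e+1)` with `b ∉ ℓ·B`. [folklore] -/
theorem exists_primePow_order_not_mem_nsmul {A : Type} [AddCommGroup A] [Finite A] (B : AddSubgroup A) (hB : B ≠ ⊥) :
    ∃ (ℓ e : ℕ), ℓ.Prime ∧ ℓ ∣ Nat.card B ∧ ∃ b ∈ B, addOrderOf b = ℓ ^ (e + 1) ∧ ∀ c ∈ B, ℓ • c ≠ b := by
  have hcard : Nat.card B ≠ 1 := fun h => hB (B.eq_bot_iff_card.2 h)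
  obtain ⟨ℓ, hℓ, hdvd⟩ := Nat.exists_prime_and_dvd hcard
  haveI : Fact ℓ.Prime := ⟨hℓ⟩
  obtain ⟨g, hg⟩ := FixedChartOfWildDegree.exists_not_mem_nsmul_of_dvd_card ℓ (G := B) hdvd
  have ho0 : addOrderOf g ≠ 0 := (isOfFinAddOrder_of_finite g).addOrderOf_pos.ne'
  obtain ⟨v, q, hq, hoq⟩ := Nat.exists_eq_pow_mul_and_not_dvd ho0 ℓ hℓ.one_lt.ne'
  have hq0 : q ≠ 0 := by rintro rfl; exact ho0 (by rw [hoq, mul_zero])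
  -- `v ≥ 1`: otherwise `ℓ` is invertible modulo `ord g` and `g ∈ ℓ·B`
  have hg0 : g ≠ 0 := fun h => hg 0 (by rw [h, nsmul_zero])
  have ho1 : 1 < addOrderOf g := by
    rcases Nat.lt_or_ge 1 (addOrderOf g) with h | h
    · exact h
    · exfalso; exact hg0 (AddMonoid.addOrderOf_eq_one_iff.1 (le_antisymm h (Nat.pos_of_ne_zero ho0)))
  obtain ⟨e, rfl⟩ : ∃ e, v = e + 1 := by
    refine Nat.exists_eq_add_one.2 (Nat.pos_of_ne_zero fun hv => ?_)
    rw [hv, pow_zero, one_mul] at hoq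
    have hcop : Nat.Coprime ℓ (addOrderOf g) := (Nat.Prime.coprime_iff_not_dvd hℓ).2 (hoq ▸ hq)
    obtain ⟨m, -, hm⟩ := Nat.exists_mul_mod_eq_one_of_coprime hcop ho1
    exact hg (m • g) (by rw [← mul_nsmul', mul_comm, nsmul_eq_self_of_mod_eq_one g (by rwa [mul_comm] at hm)])
  -- `b = q • g` has order `ℓ^(e+1)` and is not in `ℓ·B`
  have hord : addOrderOf (q • g) = ℓ ^ (e + 1) := by
    rw [addOrderOf_nsmul' g hq0, hoq, Nat.gcd_mul_left_left, Nat.mul_div_cancel _ (Nat.pos_of_ne_zero hq0)]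
  have hn1 : 1 < ℓ ^ (e + 1) := Nat.one_lt_pow (Nat.succ_ne_zero e) hℓ.one_lt
  have hnot : ∀ c : B, ℓ • c ≠ q • g := by
    intro c hc
    have hcop : Nat.Coprime q (ℓ ^ (e + 1)) := (Nat.Coprime.pow_left (e + 1) ((Nat.Prime.coprime_iff_not_dvd hℓ).2 hq)).symm
    obtain ⟨α, -, hα⟩ := Nat.exists_mul_mod_eq_one_of_coprime hcop hn1
    have hqa : q * α = ℓ ^ (e + 1) * (q * α / ℓ ^ (e + 1)) + 1 := by
      have h := Nat.div_add_mod (q * α) (ℓ ^ (e + 1)); rw [hα] at h; exact h.symm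
    apply hg (α • c - (q * α / ℓ ^ (e + 1) * ℓ ^ e) • g)
    have h1 : (q * α) • g = (ℓ ^ (e + 1) * (q * α / ℓ ^ (e + 1))) • g + g := by
      conv_lhs => rw [hqa, add_nsmul, one_nsmul]
    rw [nsmul_sub, smul_smul, smul_smul, mul_comm ℓ α, ← smul_smul, hc, smul_smul,
      show ℓ * (q * α / ℓ ^ (e + 1) * ℓ ^ e) = ℓ ^ (e + 1) * (q * α / ℓ ^ (e + 1)) by ring, mul_comm α q,
      h1, add_sub_cancel_left]
  refine ⟨ℓ, e, hℓ, hdvd, ((q • g : B) : A), (q • g).2, ?_, fun c hc h => hnot ⟨c, hc⟩ (Subtype.ext ?_)⟩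
  · rw [← hord]; exact addOrderOf_injective B.subtype Subtype.coe_injective (q • g)
  · simpa using h

end Summit.ResolutionOfSingularities.ResolutionOfSingularities.Theorems.FRationalResolution.RechartDegree

end
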